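import Summits.Ventures.CertifiedArithmetic.LowPrec.GemmThetaE2M1Fp16
import Summits.Ventures.CertifiedArithmetic.LowPrec.GemmWorstCaseE2M1
import Summits.Ventures.CertifiedArithmetic.LowPrec.GemmTerminalBinary16

/-!
# Prop. Θ(i) for E2M1²→binary16, kernel-checked: `1 - W(n) ≥ 1666/(8n + 20825)` for every `n`

HONEST FRAMING (venture CertifiedArithmetic / cell `pub-lowprec`, seat gemm, gen 10): certified error
envelopes and provably optimal rounding/accumulation schemes for low-precision formats under stated
cost models; every table by two implementations; no hardware or vendor claims.

Paper `gemm.tex` §Regimes, Prop. "the terminal constant bounds the defect for every n" (i), for the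
FP4 configuration E2M1·E2M1 → `binary16` (exact products, sequential accumulation, RNE; value set
[RouhaniEtAl2023MX, Table 1]; the accumulator model is the cell's `seqSum Format.Binary16`, whose
rounding saturates at `±65504` — IEEE arithmetic on every input none of whose partial sums reaches
`65520`, the paper's `FIN(n)`; the maximum of the relative error over `FIN(n)` is at most the maximum
over all words stated here, and the lower-bound family never exceeds `32832`).  From the kernel-checked
certificate `thetaCert_E2M1_Binary16` (`GemmThetaE2M1Fp16.lean`, 681,984 edges) and the generic
soundness theorem `ThetaCertificate.defect_bound`:
* `defect_bound_E2M1_Binary16`: `1666/(8n + 20825) ≤ 1 - (ŝ_m - Σ x)/Σ|x|` for every input of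
  letters `x 0 … x m` (`n = m + 1`), the two-sided `abs_err_le_E2M1_Binary16`, and the GEMM phrasing
  `abs_dot_err_le_E2M1_Binary16` over E2M1 data `a j`, `b j` (`mul_mem_piE2M1`, `GemmTieChains.lean`);
* `W(n)` of this configuration as a Lean term (`worstRelErrE2M1FP16 m`, the maximum of `relErr` over
  the `37^(m+1)` words `wordInput` of `GemmWorstCaseE2M1.lean`) with `worstFp16_le` (the bound above,
  every `n`), `worstFp16_ge` (the tie-chain family `TieChain.fp16_5649` of `GemmTerminalBinary16.lean`,
  `n ≥ 5649`) and the sandwich `1666/(8n + 20825) ≤ 1 - W(n) ≤ 1666/(8n - 36151)`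
  (`worstFp16_sandwich`) — two hyperbolas `7122` apart in `n`; the cell's two-implementation TERMINAL
  certificate (`certs/gemm/regimes/terminal_n11296_e2m1_e2m1_binary16_exact_RNE_a.json`, not
  kernel-checked) says the upper one is exact from `n = 11296` on.
With this file all seven itemized rows of the paper's θ-list (§Regimes: E2M1²→bfloat16/binary16, E2M3², E3M2²,
E4M3², E5M2², E4M3·E5M2 → bfloat16) have both sides of `1 - W(n)` kernel-checked; the `θ_p` sweeps and the mixed /
binary16 pairs quoted inline there remain two-implementation certificates.
-/

namespace Literature.ComputerArithmetic.FloatingPoint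

namespace MiniFloat

open Finset

/-! ### The bound -/

/-- PROP. Θ(i) FOR E2M1²→binary16, KERNEL-CHECKED: for every input of E2M1·E2M1 products
`x 0, …, x m` (`n = m + 1` terms, not all zero) accumulated sequentially in `binary16` (RNE, the
saturating model), `1666/(8n + 20825) ≤ 1 - (ŝ_m - Σ x)/Σ|x|`.
[cell, gemm.tex §Regimes Prop. Θ(i) — now a theorem] -/
theorem defect_bound_E2M1_Binary16 (x : ℕ → ℚ) (hx : ∀ j, x j ∈ piE2M1) (m : ℕ)
    (hL : 0 < ∑ j ∈ range (m + 1), |x j|) :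
    1666 / (8 * (m + 1) + 20825)
      ≤ 1 - ((seqSum Format.Binary16 x m).toRat - ∑ j ∈ range (m + 1), x j)
          / ∑ j ∈ range (m + 1), |x j| := by
  have h := thetaCert_E2M1_Binary16.defect_bound x hx m hL
  rw [show max (7 / 2 : ℚ) (23 / 2) + 4 / 833 = 19167 / 1666 by norm_num,
    theta_bound_E2M1_Binary16_const] at h
  exact h

/-- TWO-SIDED FORM: `|ŝ_m - Σ x| ≤ (1 - 1666/(8n + 20825)) · Σ|x|` for every input of E2M1·E2M1
products into `binary16`, i.e. `W(n) ≤ (8n + 19159)/(8n + 20825)` for every `n`.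
[cell, gemm.tex §Regimes Prop. Θ(i)] -/
theorem abs_err_le_E2M1_Binary16 (x : ℕ → ℚ) (hx : ∀ j, x j ∈ piE2M1) (m : ℕ) :
    |(seqSum Format.Binary16 x m).toRat - ∑ j ∈ range (m + 1), x j|
      ≤ (1 - 1666 / (8 * (m + 1) + 20825)) * ∑ j ∈ range (m + 1), |x j| := by
  by_cases hL : ∑ j ∈ range (m + 1), |x j| = 0
  · -- all terms vanish
    have hz : ∀ j ∈ range (m + 1), x j = 0 := by
      intro j hj
      have := (sum_eq_zero_iff_of_nonneg fun i _ => abs_nonneg (x i)).mp hL j hj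
      exact abs_eq_zero.mp this
    have hs : ∀ k ≤ m, (seqSum Format.Binary16 x k).toRat = 0 := by
      intro k hk
      induction k with
      | zero => simp [seqSum, hz 0 (by simp), toRat_roundNE_zero]
      | succ k ih =>
          simp only [seqSum]
          rw [ih (by omega), hz (k + 1) (mem_range.mpr (by omega)), add_zero, toRat_roundNE_zero]
    rw [hs m le_rfl, sum_eq_zero hz, hL]; simp
  · have hpos : 0 < ∑ j ∈ range (m + 1), |x j| :=
      lt_of_le_of_ne (sum_nonneg fun i _ => abs_nonneg (x i)) (Ne.symm hL)
    have h1 := defect_bound_E2M1_Binary16 x hx m hpos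
    have hx' : ∀ j, (fun j => -x j) j ∈ piE2M1 := fun j => neg_mem_piE2M1 (hx j)
    have h2 := defect_bound_E2M1_Binary16 (fun j => -x j) hx' m (by simpa using hpos)
    simp only [abs_neg, sum_neg_distrib, toRat_seqSum_neg] at h2
    rw [abs_le]
    constructor
    · have := (le_sub_comm.mp h2)
      rw [div_le_iff₀ hpos] at this
      linarith
    · have := (le_sub_comm.mp h1)
      rw [div_le_iff₀ hpos] at this
      linarith

/-- THE GEMM PHRASING: for every `n = m + 1` pairs of E2M1 data `a j, b j` (exact products,
accumulated sequentially in `binary16`, RNE) the inner-product error satisfies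
`|ŝ - Σ a_j b_j| ≤ (1 - 1666/(8n + 20825)) · Σ|a_j b_j|`. [cell, gemm.tex §Regimes Prop. Θ(i)] -/
theorem abs_dot_err_le_E2M1_Binary16 (a b : ℕ → MiniFloat Format.E2M1) (m : ℕ) :
    |(seqSum Format.Binary16 (fun j => (a j).toRat * (b j).toRat) m).toRat
        - ∑ j ∈ range (m + 1), (a j).toRat * (b j).toRat|
      ≤ (1 - 1666 / (8 * (m + 1) + 20825))
          * ∑ j ∈ range (m + 1), |(a j).toRat * (b j).toRat| :=
  abs_err_le_E2M1_Binary16 _ (fun j => mul_mem_piE2M1 (a j) (b j)) m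

/-! ### `W(n)` of E2M1²→binary16 as a defined maximum, sandwiched for `n ≥ 5649` -/

/-- `W(n)` OF E2M1²→binary16 (sequential, RNE, exact products, the saturating model), `n = m + 1`:
the maximum of the relative error over all `37^(m+1)` inputs of letters. [cell, gemm.tex §Model] -/
def worstRelErrE2M1FP16 (m : ℕ) : ℚ :=
  (univ : Finset (Fin (m + 1) → Fin 37)).sup' univ_nonempty
    (fun w => relErr Format.Binary16 (wordInput w) m)

/-- Every input of letters is dominated by `W(n)` (binary16 accumulator). [cell, gemm.tex §Model] -/
theorem relErr_le_worstFp16 (x : ℕ → ℚ) (hx : ∀ j, x j ∈ piE2M1) (m : ℕ) :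
    relErr Format.Binary16 x m ≤ worstRelErrE2M1FP16 m := by
  classical
  have hidx : ∀ j, ∃ i : Fin 37, ∀ h : i.val < piE2M1.length, piE2M1[i.val]'h = x j := by
    intro j
    obtain ⟨i, hi, h⟩ := List.getElem_of_mem (hx j)
    exact ⟨⟨i, by simpa [piE2M1_length] using hi⟩, fun _ => h⟩
  choose f hf using hidx
  have hxy : ∀ j ≤ m, x j = wordInput (fun j : Fin (m + 1) => f j.val) j := by
    intro j hj
    unfold wordInput
    rw [dif_pos (by omega)]
    exact (hf j _).symm
  rw [relErr_congr Format.Binary16 hxy]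
  exact le_sup' (fun w => relErr Format.Binary16 (wordInput w) m) (mem_univ _)

/-- UPPER BOUND FOR EVERY `n` (Prop. Θ(i), kernel-checked): `W(n) ≤ 1 - 1666/(8n + 20825)` for
E2M1²→binary16. [cell, gemm.tex §Regimes Prop. Θ(i)] -/
theorem worstFp16_le (m : ℕ) :
    worstRelErrE2M1FP16 m ≤ 1 - 1666 / (8 * (m + 1) + 20825) := by
  apply sup'_le
  intro w _
  unfold relErr
  have hc : (0 : ℚ) ≤ 1 - 1666 / (8 * (m + 1) + 20825) := by
    rw [sub_nonneg, div_le_one (by positivity)]; linarith [show (0 : ℚ) ≤ m from Nat.cast_nonneg m]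
  by_cases hL : ∑ j ∈ range (m + 1), |wordInput w j| = 0
  · rw [hL, div_zero]; exact hc
  · have hpos : 0 < ∑ j ∈ range (m + 1), |wordInput w j| :=
      lt_of_le_of_ne (sum_nonneg fun i _ => abs_nonneg _) (Ne.symm hL)
    rw [div_le_iff₀ hpos]
    exact abs_err_le_E2M1_Binary16 _ (wordInput_mem w) m

/-- LOWER BOUND FOR EVERY `n ≥ 5649` (the terminal family of `GemmTerminalBinary16.lean`,
kernel-checked): `(8n - 37817)/(8n - 36151) ≤ W(n)`. [cell, gemm.tex §Regimes Prop. "all n" (iii)] -/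
theorem worstFp16_ge (m : ℕ) (hm : 5648 ≤ m) :
    (8 * ((m : ℚ) + 1) - 37817) / (8 * (m + 1) - 36151) ≤ worstRelErrE2M1FP16 m := by
  have h := TieChain.fp16_5649_ratio (m + 1) (by omega)
  rw [Nat.add_sub_cancel] at h
  have hw := relErr_le_worstFp16 TieChain.fp16_5649 TieChain.fp16_5649_mem m
  unfold relErr at hw
  rw [h] at hw
  push_cast at hw
  exact hw

/-- THE SANDWICH FOR EVERY `n ≥ 5649`, both sides kernel-checked:
`1666/(8n + 20825) ≤ 1 - W(n) ≤ 1666/(8n - 36151)` for E2M1²→binary16. [cell, gemm.tex §Regimes] -/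
theorem worstFp16_sandwich (m : ℕ) (hm : 5648 ≤ m) :
    1666 / (8 * ((m : ℚ) + 1) + 20825) ≤ 1 - worstRelErrE2M1FP16 m ∧
      1 - worstRelErrE2M1FP16 m ≤ 1666 / (8 * ((m : ℚ) + 1) - 36151) := by
  refine ⟨by linarith [worstFp16_le m], ?_⟩
  have h := worstFp16_ge m hm
  have hm' : (5648 : ℚ) ≤ m := by exact_mod_cast hm
  have hden : (0 : ℚ) < 8 * ((m : ℚ) + 1) - 36151 := by linarith
  have e : (8 * ((m : ℚ) + 1) - 37817) / (8 * (m + 1) - 36151)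
      = 1 - 1666 / (8 * ((m : ℚ) + 1) - 36151) := by
    field_simp; ring
  linarith [e]

end MiniFloat

end Literature.ComputerArithmetic.FloatingPoint
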